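import Mathlib

/-!
# Crux `RigidityForcesSymmetry.RigidMinimalRepr` (stmt-ValiantsHypothesis-4163), line `registered` —
# stub `stub_sliceOpen` (the orbit–slice map is open at the base point)

Route `ValiantsHypothesis/RigidityForcesSymmetry`, crux `RigidMinimalRepr`, skeleton
`Cruxes/RigidMinimalRepr/Lines/registered.lean` (lead's reshape v2), stub 2a.

**Statement.** For a pencil `x₀ = (Λ, A)` of size `m` over a finite variable type `ι` and a linear subspace `W`
of coefficient space `X = M_m(ℂ) × (ι → M_m(ℂ))` with `X = T + W`, `T = {(PΛ + ΛQ, (PA_v + A_vQ)_v)}` the gauge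
tangent space, the polynomial map `Θ(P, Q, w) = ((1+P)(Λ+w₁)(1+Q), ((1+P)(A_v+w₂ᵥ)(1+Q))_v)` maps every
neighbourhood `V` of `0` onto a neighbourhood of `x₀` using only slice parameters `w ∈ W`: there is `U ∈ 𝓝 x₀`
all of whose points are `Θ(q)` with `q ∈ V`, `q.2 ∈ W`.

**Proof.** Restricted to `E = (M × M) × W`, `Θ` has strict derivative `((P, Q), w) ↦ (PΛ + ΛQ, …) + w` at `0`
(matrix multiplication is a bounded bilinear map in finite dimensions; chain rule), which is onto `X` by
hypothesis; the inverse function theorem in the form `HasStrictFDerivAt.map_nhds_eq_of_surj` gives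
`map Θ (𝓝 0) = 𝓝 x₀`, so the image of (the pull-back to `E` of) `V` is a neighbourhood of `x₀`.  Matrices carry
the elementwise sup norm (`Matrix.Norms.Elementwise`), whose topology is the product topology of the statement.
-/

set_option autoImplicit false

-- the mandated summit-side namespace repeats a component by design (single-problem summit)
set_option linter.dupNamespace false

noncomputable section

open scoped Matrix.Norms.Elementwise Topology
open Filter Set

namespace Summit.ValiantsHypothesis.ValiantsHypothesis.Theorems.RigidityForcesSymmetryRigidMinimalRepr

namespace SliceOpen

variable {ι : Type} {m : ℕ}

local notation "M" => Matrix (Fin m) (Fin m) ℂ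
local notation "X" => Matrix (Fin m) (Fin m) ℂ × (ι → Matrix (Fin m) (Fin m) ℂ)

/-- Matrix multiplication on `M_m(ℂ)` is a bounded bilinear map (any bilinear map on a finite-dimensional
space is). -/
theorem isBoundedBilinearMap_matrix_mul : IsBoundedBilinearMap ℂ fun p : M × M => p.1 * p.2 := by
  let L : M →ₗ[ℂ] (M →L[ℂ] M) :=
    (LinearMap.toContinuousLinearMap : (M →ₗ[ℂ] M) ≃ₗ[ℂ] (M →L[ℂ] M)).toLinearMap ∘ₗ LinearMap.mul ℂ M
  exact (LinearMap.toContinuousLinearMap L).isBoundedBilinearMap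

/-- Product rule for `y ↦ (1 + a y)(b₀ + b y)(1 + c y)` at `y = 0` with continuous linear `a, b, c`: a strict
derivative `D` with `D v = a v · b₀ + b₀ · c v + b v`. -/
theorem hasStrictFDerivAt_mul3 {E : Type*} [NormedAddCommGroup E] [NormedSpace ℂ E]
    (la lb lc : E →L[ℂ] M) (b0 : M) :
    ∃ D : E →L[ℂ] M, HasStrictFDerivAt (fun y => (1 + la y) * (b0 + lb y) * (1 + lc y)) D 0 ∧
      ∀ v, D v = la v * b0 + b0 * lc v + lb v := by
  have hB := isBoundedBilinearMap_matrix_mul (m := m)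
  have ha : HasStrictFDerivAt (fun y => 1 + la y) la 0 := la.hasStrictFDerivAt.const_add 1
  have hb : HasStrictFDerivAt (fun y => b0 + lb y) lb 0 := lb.hasStrictFDerivAt.const_add b0
  have hc : HasStrictFDerivAt (fun y => 1 + lc y) lc 0 := lc.hasStrictFDerivAt.const_add 1
  have hab : HasStrictFDerivAt (fun y => (1 + la y) * (b0 + lb y))
      ((hB.deriv (1 + la 0, b0 + lb 0)).comp (la.prod lb)) 0 :=
    (hB.hasStrictFDerivAt (1 + la 0, b0 + lb 0)).comp (0 : E) (ha.prodMk hb)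
  have habc : HasStrictFDerivAt (fun y => (1 + la y) * (b0 + lb y) * (1 + lc y))
      ((hB.deriv ((1 + la 0) * (b0 + lb 0), 1 + lc 0)).comp
        (((hB.deriv (1 + la 0, b0 + lb 0)).comp (la.prod lb)).prod lc)) 0 :=
    (hB.hasStrictFDerivAt ((1 + la 0) * (b0 + lb 0), 1 + lc 0)).comp (0 : E) (hab.prodMk hc)
  refine ⟨_, habc, fun v => ?_⟩
  show hB.deriv ((1 + la 0) * (b0 + lb 0), 1 + lc 0) (hB.deriv (1 + la 0, b0 + lb 0) (la v, lb v), lc v) = _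
  simp only [IsBoundedBilinearMap.deriv_apply, map_zero, add_zero, one_mul, mul_one]
  abel

/-- **Strict derivative of the orbit–slice map at `0`.** On `E = (M × M) × W` the map
`Θ_W ((P, Q), w) = ((1 + P)(Λ + w₁)(1 + Q), ((1 + P)(A_v + w₂ᵥ)(1 + Q))_v)` has a strict derivative `D` at `0` with
`D ((P, Q), w) = (PΛ + ΛQ, (PA_v + A_vQ)_v) + w`. -/
theorem hasStrictFDerivAt_sliceMap [Fintype ι] (Λ : M) (A : ι → M) (W : Submodule ℂ X) :
    ∃ D : (M × M) × ↥W →L[ℂ] X,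
      HasStrictFDerivAt
        (fun e : (M × M) × ↥W =>
          (((1 + e.1.1) * (Λ + (e.2 : X).1) * (1 + e.1.2),
            fun v => (1 + e.1.1) * (A v + (e.2 : X).2 v) * (1 + e.1.2)) : X)) D 0 ∧
      ∀ (P Q : M) (w : ↥W), D ((P, Q), w) = ((P * Λ + Λ * Q, fun v => P * A v + A v * Q) : X) + (w : X) := by
  let la : (M × M) × ↥W →L[ℂ] M := (ContinuousLinearMap.fst ℂ M M).comp (ContinuousLinearMap.fst ℂ (M × M) ↥W)
  let lc : (M × M) × ↥W →L[ℂ] M := (ContinuousLinearMap.snd ℂ M M).comp (ContinuousLinearMap.fst ℂ (M × M) ↥W)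
  let lΛ : (M × M) × ↥W →L[ℂ] M :=
    (ContinuousLinearMap.fst ℂ M (ι → M)).comp (W.subtypeL.comp (ContinuousLinearMap.snd ℂ (M × M) ↥W))
  let lA : ι → ((M × M) × ↥W →L[ℂ] M) := fun v =>
    (ContinuousLinearMap.proj v).comp
      ((ContinuousLinearMap.snd ℂ M (ι → M)).comp (W.subtypeL.comp (ContinuousLinearMap.snd ℂ (M × M) ↥W)))
  obtain ⟨D₁, hD₁, hD₁v⟩ := hasStrictFDerivAt_mul3 la lΛ lc Λ
  choose D₂ hD₂ hD₂v using fun v => hasStrictFDerivAt_mul3 la (lA v) lc (A v)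
  refine ⟨D₁.prod (ContinuousLinearMap.pi D₂), hD₁.prodMk (hasStrictFDerivAt_pi.2 hD₂), fun P Q w => ?_⟩
  refine Prod.ext ?_ (funext fun v => ?_)
  · show D₁ ((P, Q), w) = P * Λ + Λ * Q + (w : X).1
    rw [hD₁v]
    rfl
  · show D₂ v ((P, Q), w) = P * A v + A v * Q + (w : X).2 v
    rw [hD₂v]
    rfl

/-- **The orbit–slice map is open at the base point** (the content of `stub_sliceOpen`): if coefficient space is
`T + W` for the gauge tangent space `T = {(PΛ + ΛQ, (PA_v + A_vQ)_v)}`, then every neighbourhood `V` of `0` in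
`(M × M) × X` covers, through parameters `q ∈ V` with `q.2 ∈ W` only, a neighbourhood of `(Λ, A)` under `Θ`.
Inverse function theorem (`HasStrictFDerivAt.map_nhds_eq_of_surj`) for `Θ` restricted to `(M × M) × W`, whose
differential at `0` is onto by the hypothesis. -/
theorem sliceOpen [Fintype ι] (Λ : M) (A : ι → M) (W : Submodule ℂ X)
    (hT : ∀ x : X, ∃ (P Q : M), ∃ w ∈ W, x = ((P * Λ + Λ * Q, fun v => P * A v + A v * Q) : X) + w)
    (V : Set ((M × M) × X)) (hV : V ∈ 𝓝 (0 : (M × M) × X)) :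
    ∃ U ∈ 𝓝 (Λ, A), ∀ p ∈ U, ∃ q ∈ V, q.2 ∈ W ∧
      p = ((1 + q.1.1) * (Λ + q.2.1) * (1 + q.1.2), fun v => (1 + q.1.1) * (A v + q.2.2 v) * (1 + q.1.2)) := by
  obtain ⟨D, hD, hDv⟩ := hasStrictFDerivAt_sliceMap Λ A W
  -- completeness, keyed on the norm uniformities used by the inverse function theorem
  haveI : @CompleteSpace ((M × M) × ↥W) PseudoMetricSpace.toUniformSpace := FiniteDimensional.complete ℂ _
  haveI : @CompleteSpace X PseudoMetricSpace.toUniformSpace := FiniteDimensional.complete ℂ _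
  have hrange : LinearMap.range (D : (M × M) × ↥W →ₗ[ℂ] X) = ⊤ := by
    refine LinearMap.range_eq_top.2 fun x => ?_
    obtain ⟨P, Q, w, hw, rfl⟩ := hT x
    exact ⟨((P, Q), ⟨w, hw⟩), hDv P Q ⟨w, hw⟩⟩
  have hmap := hD.map_nhds_eq_of_surj hrange
  -- the small parameters, pulled back to `(M × M) × W`
  have hV' : (fun e : (M × M) × ↥W => (e.1, (e.2 : X))) ⁻¹' V ∈ 𝓝 (0 : (M × M) × ↥W) := by
    refine ContinuousAt.preimage_mem_nhds
      (continuous_fst.prodMk (continuous_subtype_val.comp continuous_snd)).continuousAt ?_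
    exact hV
  have hU := hmap.ge (image_mem_map hV')
  simp only [Prod.fst_zero, Prod.snd_zero, ZeroMemClass.coe_zero, Pi.zero_apply, add_zero, one_mul,
    mul_one] at hU
  refine ⟨_, hU, fun p hp => ?_⟩
  obtain ⟨e, he, rfl⟩ := hp
  exact ⟨(e.1, (e.2 : X)), he, e.2.2, rfl⟩

end SliceOpen

/-- **Stub 2a (`stub_sliceOpen`) of line `registered` for crux `RigidMinimalRepr`** (registered form): the
orbit–slice map `Θ` is open at `0` — every neighbourhood of `0` in `(M × M) × X` covers, through slice parameters
`w ∈ W` only, a neighbourhood of the base pencil `(Λ, A)`. -/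
theorem stub_sliceOpen :
    ∀ (ι : Type) [Fintype ι] (m : ℕ) (Λ : Matrix (Fin m) (Fin m) ℂ) (A : ι → Matrix (Fin m) (Fin m) ℂ)
      (W : Submodule ℂ (Matrix (Fin m) (Fin m) ℂ × (ι → Matrix (Fin m) (Fin m) ℂ))),
      (∀ x : Matrix (Fin m) (Fin m) ℂ × (ι → Matrix (Fin m) (Fin m) ℂ),
        ∃ (P Q : Matrix (Fin m) (Fin m) ℂ), ∃ w ∈ W,
          x = (P * Λ + Λ * Q, fun v => P * A v + A v * Q) + w) →
      ∀ V ∈ nhds (0 : (Matrix (Fin m) (Fin m) ℂ × Matrix (Fin m) (Fin m) ℂ) ×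
                    (Matrix (Fin m) (Fin m) ℂ × (ι → Matrix (Fin m) (Fin m) ℂ))),
        ∃ U ∈ nhds (Λ, A), ∀ p ∈ U, ∃ q ∈ V, q.2 ∈ W ∧
          p = ((1 + q.1.1) * (Λ + q.2.1) * (1 + q.1.2),
               fun v => (1 + q.1.1) * (A v + q.2.2 v) * (1 + q.1.2)) :=
  fun _ _ _ Λ A W hT V hV => SliceOpen.sliceOpen Λ A W hT V hV

end Summit.ValiantsHypothesis.ValiantsHypothesis.Theorems.RigidityForcesSymmetryRigidMinimalRepr

end
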